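import Summits.Ventures.PercRepro.Defs
import Summits.Ventures.PercRepro.Conditioning
import Summits.Ventures.PercRepro.Graph
import Summits.Ventures.PercRepro.FlipConcavity
import Summits.Ventures.PercRepro.ConditionalNeg

/-!
# Equality in the pair-sum inequality when a marked vertex separates the other two

If the marked vertex `b` separates `a` from `c` in `G` — there are vertex sets `X ∋ a`, `Y ∋ c`,
disjoint, not containing `b`, such that every edge touching `X` has both endpoints in `X ∪ {b}` and
every edge touching `Y` has both endpoints in `Y ∪ {b}` — then the pair-sum inequality
`y₁ y₂ + y₁ y₃ + y₂ y₃ ≤ x z` is an equality for every `p` (`MultiGraph.pair_sum_eq_of_separates`).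

Proof.  The events `{a ↔ b}` and `{b ↔ c}` are determined by the disjoint edge sets "edges
touching `X`" and "edges touching `Y`" (`dependsOnly_connEvent_of_side`, a cut-vertex argument by
induction along open paths), hence independent (`prob_inter_of_dependsOnly`); and `a ↔ c` forces
`a ↔ b` (`conn_of_conn_of_side`).  With `α = P(a ↔ b)`, `γ = P(b ↔ c)` the five partition
probabilities are `x = αγ`, `y₁ = α(1-γ)`, `y₂ = 0`, `y₃ = (1-α)γ`, `z = (1-α)(1-γ)`, and
`y₁ y₃ = x z`.

The independence lemma is itself an instance of single-flip concavity: for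
`B(ω,ω') = 1_{A∩B}(ω) - 1_A(ω) 1_B(ω')` all mixed second differences vanish, so both `B` and `-B`
satisfy the hypotheses of `expect2_nonneg_of_flipConcave`, and `E[B] = P(A ∩ B) - P(A)P(B) = 0`.
-/

namespace PercRepro

open Finset

variable {E : Type*}

/-! ### Events determined by a set of edges -/

/-- `DependsOnly A S`: the event `A` is determined by the states of the edges in `S`. -/
def DependsOnly (A : Set (Config E)) (S : Set E) : Prop :=
  ∀ ω ω' : Config E, (∀ e ∈ S, ω e = ω' e) → (ω ∈ A ↔ ω' ∈ A)

/-- Changing an edge outside `S` does not affect an event determined by `S`. -/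
theorem DependsOnly.update_iff [DecidableEq E] {A : Set (Config E)} {S : Set E}
    (h : DependsOnly A S) {e : E} (he : e ∉ S) (ω : Config E) (b : Bool) :
    Function.update ω e b ∈ A ↔ ω ∈ A :=
  h _ _ fun e' he' => by
    have hne : e' ≠ e := fun h' => he (h' ▸ he')
    exact Function.update_of_ne hne _ _

/-- The indicator of an event determined by `S` is unchanged by an edge outside `S`. -/
theorem DependsOnly.indicator_update [DecidableEq E] {A : Set (Config E)} {S : Set E}
    (h : DependsOnly A S) {e : E} (he : e ∉ S) (ω : Config E) (b : Bool) :
    A.indicator (1 : Config E → ℝ) (Function.update ω e b) = A.indicator 1 ω := by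
  by_cases hω : ω ∈ A
  · rw [Set.indicator_of_mem hω, Set.indicator_of_mem ((h.update_iff he ω b).2 hω)]
    simp only [Pi.one_apply]
  · rw [Set.indicator_of_notMem hω,
      Set.indicator_of_notMem (fun h' => hω ((h.update_iff he ω b).1 h'))]

section Indep

variable [Fintype E] [DecidableEq E]

/-- A second moment of a function of the first copy only is an expectation. -/
theorem expect2_left (p q : E → ℝ) (g : Config E → ℝ) :
    expect2 p q (fun ω _ => g ω) = expect p g := by
  unfold expect2 expect
  refine Finset.sum_congr rfl fun ω _ => ?_
  rw [← Finset.sum_mul, sum_weight, one_mul]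

/-- `expect2` of a negated function. -/
theorem expect2_neg (p q : E → ℝ) (B : Config E → Config E → ℝ) :
    expect2 p q (fun ω ω' => -B ω ω') = -expect2 p q B := by
  simpa only [neg_one_mul] using expect2_const_mul p q (-1) B

/-- **Flat second moments vanish**: if `B ω ω = 0` and all mixed second differences of `B`
vanish, then `E_p[B(ω, ω')] = 0`. -/
theorem expect2_eq_zero_of_flipFlat {p : E → ℝ} (hp : IsProb p) {B : Config E → Config E → ℝ}
    (hdiag : ∀ ω, B ω ω = 0)
    (hflat : ∀ e ω ω', B (Function.update ω e true) (Function.update ω' e true)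
        - B (Function.update ω e true) (Function.update ω' e false)
        - B (Function.update ω e false) (Function.update ω' e true)
        + B (Function.update ω e false) (Function.update ω' e false) = 0) :
    expect2 p p B = 0 := by
  have h1 := expect2_nonneg_of_flipConcave hp (B := B) (fun ω => (hdiag ω).ge)
    (fun e ω ω' => (hflat e ω ω').le)
  have h2 := expect2_nonneg_of_flipConcave hp (B := fun ω ω' => -B ω ω')
    (fun ω => by simp [hdiag ω]) (fun e ω ω' => by linarith [hflat e ω ω'])
  rw [expect2_neg] at h2
  linarith

/-- **Independence of events determined by disjoint edge sets**:
`P(A ∩ B) = P(A) · P(B)` when `A` is determined by `S`, `B` by `T`, and `S`, `T` are disjoint. -/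
theorem prob_inter_of_dependsOnly {p : E → ℝ} (hp : IsProb p) {A B : Set (Config E)}
    {S T : Set E} (hA : DependsOnly A S) (hB : DependsOnly B T) (hST : Disjoint S T) :
    prob p (A ∩ B) = prob p A * prob p B := by
  have key := expect2_eq_zero_of_flipFlat hp
    (B := fun ω ω' => (A ∩ B).indicator 1 ω - A.indicator 1 ω * B.indicator 1 ω') ?_ ?_
  · rw [expect2_sub, expect2_left, expect2_mul, expect_indicator_one, expect_indicator_one,
      expect_indicator_one] at key
    linarith
  · intro ω
    by_cases hω : ω ∈ A ∩ B
    · simp [Set.indicator_of_mem hω, Set.indicator_of_mem hω.1, Set.indicator_of_mem hω.2]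
    · rw [Set.indicator_of_notMem hω]
      by_cases hA' : ω ∈ A
      · have hB' : ω ∉ B := fun h => hω ⟨hA', h⟩
        simp [Set.indicator_of_notMem hB']
      · simp [Set.indicator_of_notMem hA']
  · intro e ω ω'
    by_cases he : e ∈ S
    · have heT : e ∉ T := Set.disjoint_left.1 hST he
      rw [hB.indicator_update heT ω' true, hB.indicator_update heT ω' false]
      ring
    · rw [hA.indicator_update he ω true, hA.indicator_update he ω false]
      ring

end Indep

/-! ### The cut-vertex lemma -/

namespace MultiGraph

variable {V : Type*} {G : MultiGraph V E}

/-- `SideOf G X b`: every edge touching `X` has both endpoints in `X ∪ {b}` — so `b` is the only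
exit from `X`. -/
def SideOf (G : MultiGraph V E) (X : Set V) (b : V) : Prop :=
  ∀ e, (G.fst e ∈ X ∨ G.snd e ∈ X) → (G.fst e ∈ X ∨ G.fst e = b) ∧ (G.snd e ∈ X ∨ G.snd e = b)

/-- **Cut-vertex induction.**  Let `b` be the only exit from `X` and `a ∈ X`.  If `ω'` agrees with
`ω` on the edges touching `X`, then every open path of `ω` from `a` to a vertex `v` of `X ∪ {b}`
yields `a ↔ v` in `ω'`, and every open path of `ω` from `a` to a vertex outside `X ∪ {b}` passes
through `b`, so that `a ↔ b` in `ω'`. -/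
theorem conn_side_induction {X : Set V} {b : V} (hX : G.SideOf X b) {a : V} (ha : a ∈ X)
    {ω ω' : Config E} (hωω' : ∀ e ∈ G.touching X, ω e = ω' e) {v : V} (h : G.Conn ω a v) :
    ((v ∈ X ∨ v = b) → G.Conn ω' a v) ∧ ((v ∉ X ∧ v ≠ b) → G.Conn ω' a b) := by
  refine Conn.induction
    (motive := fun v => ((v ∈ X ∨ v = b) → G.Conn ω' a v) ∧ ((v ∉ X ∧ v ≠ b) → G.Conn ω' a b))
    ⟨fun _ => Conn.refl G ω' a, fun h' => absurd ha h'.1⟩ ?_ h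
  intro u v _ huv ih
  obtain ⟨e, he, hend⟩ := huv
  -- if `e` touches `X` it is open in `ω'` as well
  have hopen : (u ∈ X ∨ v ∈ X) → G.OpenAdj ω' u v := by
    intro huv
    have htouch : e ∈ G.touching X := by
      rcases hend with ⟨rfl, rfl⟩ | ⟨rfl, rfl⟩
      · exact huv
      · exact huv.symm
    exact ⟨e, (hωω' e htouch) ▸ he, hend⟩
  -- if `e` touches `X`, both endpoints lie in `X ∪ {b}`
  have hboth : (u ∈ X ∨ v ∈ X) → (u ∈ X ∨ u = b) ∧ (v ∈ X ∨ v = b) := by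
    intro huv
    rcases hend with ⟨rfl, rfl⟩ | ⟨rfl, rfl⟩
    · exact hX e huv
    · exact (hX e huv.symm).symm
  constructor
  · rintro (hv | hvb)
    · -- `v ∈ X`: `u ∈ X ∪ {b}` and the edge is open in `ω'`
      exact (ih.1 (hboth (Or.inr hv)).1).trans (Conn.of_openAdj (hopen (Or.inr hv)))
    · -- `v = b`
      rw [hvb]
      by_cases hu : u ∈ X
      · have ho : G.OpenAdj ω' u b := hvb ▸ hopen (Or.inl hu)
        exact (ih.1 (Or.inl hu)).trans (Conn.of_openAdj ho)
      · by_cases hub : u = b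
        · rw [← hub]
          exact ih.1 (Or.inr hub)
        · exact ih.2 ⟨hu, hub⟩
  · rintro ⟨hv, hvb⟩
    by_cases hu : u ∈ X
    · exact absurd (hboth (Or.inl hu)).2 (by rintro (h | h) <;> contradiction)
    · by_cases hub : u = b
      · rw [← hub]
        exact ih.1 (Or.inr hub)
      · exact ih.2 ⟨hu, hub⟩

/-- If `b` is the only exit from `X ∋ a`, the event `{a ↔ b}` is determined by the edges touching
`X`. -/
theorem dependsOnly_connEvent_of_side {X : Set V} {b : V} (hX : G.SideOf X b) {a : V}
    (ha : a ∈ X) : DependsOnly (G.connEvent a b) (G.touching X) := by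
  intro ω ω' h
  constructor
  · intro hab
    exact (conn_side_induction hX ha h hab).1 (Or.inr rfl)
  · intro hab
    exact (conn_side_induction hX ha (fun e he => (h e he).symm) hab).1 (Or.inr rfl)

/-- If `b` is the only exit from `X ∋ a` and `c ∉ X ∪ {b}`, then `a ↔ c` forces `a ↔ b`. -/
theorem conn_of_conn_of_side {X : Set V} {b : V} (hX : G.SideOf X b) {a : V} (ha : a ∈ X)
    {c : V} (hc : c ∉ X) (hcb : c ≠ b) {ω : Config E} (hac : G.Conn ω a c) : G.Conn ω a b :=
  (conn_side_induction hX ha (fun _ _ => rfl) hac).2 ⟨hc, hcb⟩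

/-- The edges touching two disjoint sides of `b` are disjoint. -/
theorem disjoint_touching {X Y : Set V} {b : V} (hX : G.SideOf X b) (hbY : b ∉ Y)
    (hXY : Disjoint X Y) : Disjoint (G.touching X) (G.touching Y) := by
  rw [Set.disjoint_left]
  intro e heX heY
  obtain ⟨h1, h2⟩ := hX e heX
  rcases heY with hY | hY
  · rcases h1 with h | h
    · exact Set.disjoint_left.1 hXY h hY
    · exact hbY (h ▸ hY)
  · rcases h2 with h | h
    · exact Set.disjoint_left.1 hXY h hY
    · exact hbY (h ▸ hY)

/-! ### Equality in the pair-sum inequality -/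

section Main

variable [Fintype E] [DecidableEq E]

/-- **Equality locus of the pair-sum inequality (sufficiency).**  If the marked vertex `b`
separates `a` from `c` — `X ∋ a` and `Y ∋ c` are disjoint vertex sets, `b ∉ Y`, and `b` is the
only exit from `X` and the only exit from `Y` — then
`P({a,b}|c) P({a,c}|b) + P({a,b}|c) P({b,c}|a) + P({a,c}|b) P({b,c}|a) = P(a↔b↔c) P(a|b|c)`
for every edge-probability vector `p`. -/
theorem pair_sum_eq_of_separates {p : E → ℝ} (hp : IsProb p) (G : MultiGraph V E) (a b c : V)
    {X Y : Set V} (ha : a ∈ X) (hc : c ∈ Y) (hbY : b ∉ Y) (hXY : Disjoint X Y)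
    (hX : G.SideOf X b) (hY : G.SideOf Y b) :
    prob p (G.connEvent a b ∩ G.sepEvent a c) * prob p (G.connEvent a c ∩ G.sepEvent a b)
      + prob p (G.connEvent a b ∩ G.sepEvent a c) * prob p (G.connEvent b c ∩ G.sepEvent a b)
      + prob p (G.connEvent a c ∩ G.sepEvent a b) * prob p (G.connEvent b c ∩ G.sepEvent a b)
      = prob p (G.connEvent a b ∩ G.connEvent b c)
          * prob p (G.sepEvent a b ∩ G.sepEvent a c ∩ G.sepEvent b c) := by
  -- `a ↔ c` forces `a ↔ b` (and hence `b ↔ c`)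
  have hcX : c ∉ X := Set.disjoint_left.1 hXY.symm hc
  have hcb : c ≠ b := fun h => hbY (h ▸ hc)
  have hac_ab : ∀ ω : Config E, G.Conn ω a c → G.Conn ω a b :=
    fun ω h => conn_of_conn_of_side hX ha hcX hcb h
  -- the five events in terms of `ab := {a ↔ b}` and `bc := {b ↔ c}`
  have S1 : G.connEvent a b ∩ G.sepEvent a c = G.connEvent a b ∩ (G.connEvent b c)ᶜ := by
    ext ω
    simp only [Set.mem_inter_iff, mem_connEvent, mem_sepEvent, Set.mem_compl_iff]
    exact ⟨fun ⟨hab, hac⟩ => ⟨hab, fun hbc => hac (hab.trans hbc)⟩,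
      fun ⟨hab, hbc⟩ => ⟨hab, fun hac => hbc (hab.symm.trans hac)⟩⟩
  have S2 : G.connEvent a c ∩ G.sepEvent a b = ∅ := by
    ext ω
    simp only [Set.mem_inter_iff, mem_connEvent, mem_sepEvent, Set.mem_empty_iff_false,
      iff_false, not_and, not_not]
    exact hac_ab ω
  have S3 : G.connEvent b c ∩ G.sepEvent a b = (G.connEvent a b)ᶜ ∩ G.connEvent b c := by
    ext ω
    simp only [Set.mem_inter_iff, mem_connEvent, mem_sepEvent, Set.mem_compl_iff]
    exact and_comm
  have S4 : G.sepEvent a b ∩ G.sepEvent a c ∩ G.sepEvent b c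
      = (G.connEvent a b)ᶜ ∩ (G.connEvent b c)ᶜ := by
    ext ω
    simp only [Set.mem_inter_iff, mem_sepEvent, Set.mem_compl_iff]
    exact ⟨fun ⟨⟨hab, _⟩, hbc⟩ => ⟨hab, hbc⟩,
      fun ⟨hab, hbc⟩ => ⟨⟨hab, fun hac => hab (hac_ab ω hac)⟩, hbc⟩⟩
  -- independence of `ab` and `bc`
  have hdepA : DependsOnly (G.connEvent a b) (G.touching X) := dependsOnly_connEvent_of_side hX ha
  have hdepB : DependsOnly (G.connEvent b c) (G.touching Y) := by
    rw [connEvent_comm]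
    exact dependsOnly_connEvent_of_side hY hc
  have hind : prob p (G.connEvent a b ∩ G.connEvent b c)
      = prob p (G.connEvent a b) * prob p (G.connEvent b c) :=
    prob_inter_of_dependsOnly hp hdepA hdepB (disjoint_touching hX hbY hXY)
  -- the algebra
  set α := prob p (G.connEvent a b) with hα
  set γ := prob p (G.connEvent b c) with hγ
  have h1 := prob_inter_add_prob_inter_compl p (G.connEvent a b) (G.connEvent b c)
  have h2 := prob_inter_add_prob_inter_compl p (G.connEvent a b)ᶜ (G.connEvent b c)
  have h3 := prob_compl p (G.connEvent a b)
  have h4 : prob p ((G.connEvent a b)ᶜ ∩ G.connEvent b c)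
      = prob p (G.connEvent b c) - prob p (G.connEvent a b ∩ G.connEvent b c) := by
    have := prob_inter_add_prob_inter_compl p (G.connEvent b c) (G.connEvent a b)
    rw [Set.inter_comm] at this
    rw [Set.inter_comm]
    linarith
  rw [S1, S2, S3, S4, prob_empty, hind]
  rw [hind] at h1 h4
  rw [h4] at h2
  rw [h3] at h2
  have e1 : prob p (G.connEvent a b ∩ (G.connEvent b c)ᶜ) = α - α * γ := by linarith
  have e2 : prob p ((G.connEvent a b)ᶜ ∩ (G.connEvent b c)ᶜ) = 1 - α - γ + α * γ := by linarith
  rw [e1, e2, h4]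
  ring

end Main

end MultiGraph

end PercRepro
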